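import Mathlib
import Summits.ResolutionOfSingularities.ResolutionOfSingularities.Theorems.WeightedInvariantLocalWeightedDropNCPolyBridgeExit
import Summits.ResolutionOfSingularities.ResolutionOfSingularities.Theorems.WeightedInvariantLocalWeightedDropWeierstrassForm
import Summits.ResolutionOfSingularities.ResolutionOfSingularities.Theorems.WeightedInvariantLocalWeightedDropConeDichotomyAux
import Summits.ResolutionOfSingularities.ResolutionOfSingularities.Theorems.WeightedInvariantLocalWeightedDropWildPurePowerUnaryExit
import Summits.ResolutionOfSingularities.ResolutionOfSingularities.Theorems.WeightedInvariantLocalWeightedDropTOT2NearDim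

/-!
# `WeightedInvariant.LocalWeightedDrop`, TOT2-LINE piece S-E2′ (the count-game bridge), part 5: ENTRY — a position whose tangent cone is a `d`-th
# power of a plane represents a well-prepared positive label, so the regime theorem applies to it

Crux item stmt-ResolutionOfSingularities-8899 `LocalWeightedDrop` (route `ResolutionOfSingularities/WeightedInvariant`), ENGINE skeleton v32
(ddb48572591139d5), registered stub `stub_spaceNCRankDrop`; TOT2-LINE v1.2 §(E)/(G1) piece S-E2′ (`L/res-L1-w43-lead-1/g4/TOT2-LINE.md`).
[OURS · L1 W4.3 · chain w43 · lead-1 gen 4; bricks: res-type-083's Weierstrass–Tschirnhaus normal form `WeierstrassForm.exists_monicForm`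
(`[Infinite k]`), ρ-P `PolyDescent.stub_polyPrep`, parts 1a–4 of this bridge.  MODEL: Cossart–Jannsen–Saito LNM 2270 §8 (the polyhedron
`Δ(f; u; y)` is defined once `in(f) = λ·Y^d`, i.e. `e = 2`).  Nothing here is a statement of any manuscript; AI-produced, gate-checked, weaker than
expert review.]

* `represents_of_unaryCone` — `ord b ≥ d`, `in_d(b) = λ·ℓ^d` (`ℓ ≠ 0`, `λ ≠ 0`) ⇒ `∃ A`, `IsPosT d A ∧ Represents b d A ∅`;
* `exists_represents_wellPrepared` — the same with `A` well-prepared (preparation is free);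
* **`germIsNC_or_dWinsTo_exit`** — such a position is a normal crossing already, or represents a regime label from which the mover forces an exit
  (`dWinsTo_exit`);
* **`germIsNC_or_dWinsTo_exit_of_two_inv`** — the same from the crew's «e = 2» vocabulary: two independent translation-invariance vectors of the
  degree-`d` form (`WildPurePower.cone_eq_of_wide` + `TOT2Near.order_ne_of_forall_inv` for `λ ≠ 0`).
-/

set_option linter.dupNamespace false -- mandated namespace of this single-conjunct summit

noncomputable section

namespace Summit.ResolutionOfSingularities.ResolutionOfSingularities.Theorems

namespace NCPoly

open MvPowerSeries Literature.AlgebraicGeometry.Resolution TameFourTupleDrop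

variable {k : Type} [Field k]

/-! ## ENTRY: a position with tangent cone `λ · ℓ^d` represents a positive label -/

/-- **ENTRY OF THE REGIME «e = 2».**  A position `b` of order `≥ d` whose degree-`d` initial form is a non-zero multiple of the `d`-th power of a
non-zero linear form (the directrix is a plane: `e = 2`) represents, with empty boundary, a POSITIVE label: Weierstrass–Tschirnhaus
(`WeierstrassForm.exists_monicForm`, res-type-083) after the linear change straightening `ℓ` to `y`. -/
theorem represents_of_unaryCone [Infinite k] {b : MvPowerSeries (Fin 3) k} {d : ℕ} (hbo : (d : ℕ∞) ≤ b.order)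
    (ℓ : Fin 3 → k) (hℓ : ℓ ≠ 0) (la : k) (hla : la ≠ 0)
    (hcone : ∀ v : Fin 3 → k, CobordantChart.initEval (fun _ : Fin 3 => 1) v d b = la * dotProduct ℓ v ^ d) :
    ∃ A : Fin d → MvPowerSeries (Fin 2) k, PolyDescent.IsPosT d A ∧ Represents b d A ∅ := by
  obtain ⟨M, H, A, hM, hH, hA, heq⟩ := WeierstrassForm.exists_monicForm (m := 2) b d hbo ℓ hℓ la hla hcone
  refine ⟨A, hA, FormalCoordChange.linSubst M, H, ConeDichotomy.constantCoeff_linSubst M, ?_, hH, ?_⟩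
  · rw [ConeDichotomy.linMat_linSubst]; exact hM
  · rw [heq, bdry, Finset.prod_empty, mul_one]; rfl

/-- **ENTRY, PREPARED.**  The same position represents a WELL-PREPARED positive label (ρ-P `stub_polyPrep`; preparation is free, `Represents.shift`). -/
theorem exists_represents_wellPrepared [Infinite k] {b : MvPowerSeries (Fin 3) k} {d : ℕ} (hd : 0 < d) (hbo : (d : ℕ∞) ≤ b.order)
    (ℓ : Fin 3 → k) (hℓ : ℓ ≠ 0) (la : k) (hla : la ≠ 0)
    (hcone : ∀ v : Fin 3 → k, CobordantChart.initEval (fun _ : Fin 3 => 1) v d b = la * dotProduct ℓ v ^ d) :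
    ∃ A : Fin d → MvPowerSeries (Fin 2) k, PolyDescent.IsPosT d A ∧ PolyDescent.WellPrepared d A ∧ Represents b d A ∅ := by
  obtain ⟨A, hA, hrep⟩ := represents_of_unaryCone hbo ℓ hℓ la hla hcone
  obtain ⟨hχ0, hpos', hWP', -⟩ := PolyDescent.isPrepRecentring_prepPsi (PolyDescent.stub_polyPrep k d hd A hA)
  exact ⟨_, hpos', hWP', hrep.shift hχ0⟩

/-- **S-E2′ FROM A BARE POSITION.**  A position of order `≥ d ≥ 1` with planar directrix (`in_d b = λ·ℓ^d`) is EITHER already a normal crossing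
(the prepared label is `0`: `b ~ unit · ỹ^d`) OR represents a regime label, from which the mover forces an exit (`dWinsTo_exit`). -/
theorem germIsNC_or_dWinsTo_exit [Infinite k] {b : MvPowerSeries (Fin 3) k} {d : ℕ} (hd : 0 < d) (hbo : (d : ℕ∞) ≤ b.order)
    (ℓ : Fin 3 → k) (hℓ : ℓ ≠ 0) (la : k) (hla : la ≠ 0)
    (hcone : ∀ v : Fin 3 → k, CobordantChart.initEval (fun _ : Fin 3 => 1) v d b = la * dotProduct ℓ v ^ d) :
    GermIsNC b ∨ ∃ A : Fin d → MvPowerSeries (Fin 2) k, PolyDescent.InPoly d A ∧ Represents b d A ∅ ∧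
      DWinsTo (m := 2) (Prod.fst : MvPowerSeries (Fin 3) k × (Fin d → MvPowerSeries (Fin 2) k) × Finset (Fin 2) → MvPowerSeries (Fin 3) k)
        (Exit d) (b, A, ∅) := by
  obtain ⟨A, hA, hWP, hrep⟩ := exists_represents_wellPrepared hd hbo ℓ hℓ la hla hcone
  by_cases hne : (WildMonic.newtonSet A).Nonempty
  · exact Or.inr ⟨A, ⟨hWP, hA, hne⟩, hrep, dWinsTo_exit hd (b, A, ∅) hrep ⟨hWP, hA, hne⟩⟩
  · exact Or.inl (germIsNC_of_represents_of_not_nonempty hrep hne)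

/-- `λ ≠ 0` in the cone form of a germ of order exactly `d ≥ 1`. -/
theorem la_ne_zero_of_cone [Infinite k] {b : MvPowerSeries (Fin 3) k} {d : ℕ} (hd : 0 < d) (hbo : b.order = d) {ℓ : Fin 3 → k} {la : k}
    (hcone : ∀ v : Fin 3 → k, CobordantChart.initEval (fun _ : Fin 3 => 1) v d b = la * dotProduct ℓ v ^ d) : la ≠ 0 := by
  intro hla
  refine TOT2Near.order_ne_of_forall_inv hd (f := b) (fun u v => ?_) hbo
  rw [hcone, hcone, hla, zero_mul, zero_mul]

/-- **ENTRY FROM TWO INVARIANCE VECTORS («e = 2»).**  A position of order `d ≥ 1` whose degree-`d` form has two linearly independent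
translation-invariance vectors (the directrix is a plane) is a normal crossing already, or represents a regime label from which the mover forces
an exit. -/
theorem germIsNC_or_dWinsTo_exit_of_two_inv [Infinite k] {b : MvPowerSeries (Fin 3) k} {d : ℕ} (hd : 0 < d) (hbo : b.order = d)
    (c₁ c₂ : Fin 3 → k) (hind : ∀ α β : k, α • c₁ + β • c₂ = 0 → α = 0 ∧ β = 0)
    (h₁ : ∀ v : Fin 3 → k, CobordantChart.initEval (fun _ : Fin 3 => 1) (v + c₁) d b = CobordantChart.initEval (fun _ : Fin 3 => 1) v d b)
    (h₂ : ∀ v : Fin 3 → k, CobordantChart.initEval (fun _ : Fin 3 => 1) (v + c₂) d b = CobordantChart.initEval (fun _ : Fin 3 => 1) v d b) :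
    GermIsNC b ∨ ∃ A : Fin d → MvPowerSeries (Fin 2) k, PolyDescent.InPoly d A ∧ Represents b d A ∅ ∧
      DWinsTo (m := 2) (Prod.fst : MvPowerSeries (Fin 3) k × (Fin d → MvPowerSeries (Fin 2) k) × Finset (Fin 2) → MvPowerSeries (Fin 3) k)
        (Exit d) (b, A, ∅) := by
  obtain ⟨la, ℓ, hℓ, hcone⟩ := WildPurePower.cone_eq_of_wide b d c₁ c₂ hind h₁ h₂
  exact germIsNC_or_dWinsTo_exit hd hbo.symm.le ℓ hℓ la (la_ne_zero_of_cone hd hbo hcone) hcone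

end NCPoly

end Summit.ResolutionOfSingularities.ResolutionOfSingularities.Theorems

end
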